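import Summits.HodgeConjecture.HodgeConjecture.Theorems.HeckePrymWeilWeilVariationalHodgeBaseReduction
import Summits.HodgeConjecture.HodgeConjecture.Theorems.AnchorTransportVariationalHodgeStubDominanceAlongSmooth
import Literature.AlgebraicGeometry.Motives.CurveThroughTwoPointsProofs
import Literature.AlgebraicGeometry.HodgeTheory.AlgebraicityLocusBoundary
import Literature.AlgebraicGeometry.HodgeTheory.ZariskiClosedNowhereDense
import Mathlib.AlgebraicGeometry.Morphisms.UniversallyOpen

/-!
# Route HeckePrymWeil — `WeilVariationalHodge` (stmt-HodgeConjecture-14497), line `Sketch`, skeleton v4: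
# reduction to SECTIONED families over smooth irreducible affine curves (`stub_sectionedCurveReduction`)

Registered stub `stub_sectionedCurveReduction` of skeleton v4 (lead c3). The rung `(p, M)` of the crux
`HeckePrymWeil.WeilVariationalHodge` over smooth irreducible AFFINE bases `S` follows from the rung for smooth
projective families over smooth irreducible affine CURVES `C` that carry a SECTION `e : C ⟶ 𝒳`, `e ≫ f = 𝟙`.

Proof. The section is manufactured by drawing the curve INSIDE THE TOTAL SPACE: for a `ℂ`-morphism
`k : C ⟶ 𝒳` the base change of `f` along `k ≫ f : C ⟶ S` (`Motives.familyPullback`) is again a smooth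
projective family (`IsSmoothProjectiveFamily.familyPullback_snd`), its fibre over `c ∈ C(ℂ)` is the fibre of
`f` over `f (k c)` (`familyPullback_fibrewise_rational_hodge`, `familyPullback_fibrewise_weil`,
`familyPullback_mem_algebraicClasses_iff`, p86972), and `(k, 𝟙) : C ⟶ 𝒳 ×_S C` is a section
(`IsPullback.lift`); so the sectioned curve rung moves algebraicity of the restrictions of a global class `W`
between the base points under any two complex points of such a curve
(`mem_algebraicClasses_of_curve_into_totalSpace`). Curves come from Mumford's lemma in the tree's proved
form (`Motives.mumford_smoothCurve_through_two_points_holds`: two distinct complex points on a closed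
irreducible subset of an affine `ℂ`-scheme locally of finite type lie under a smooth irreducible affine
curve mapping into that subset), applied in an affine chart `V ↪ 𝒳` to two complex points on a common
irreducible component of `V` (`mem_algebraicClasses_of_isIrreducible_chart`).

To join the anchor `s₀` to the target `s`: pick complex points `x₀ ∈ 𝒳_{s₀}(ℂ)`, `x₁ ∈ 𝒳_s(ℂ)`
(`nonempty_complexPoints`), affine charts `Vᵢ ↪ 𝒳` through them and the non-empty opens `Oᵢ ⊆ Vᵢ`
complementary to the irreducible components of the Noetherian `Vᵢ` other than the component `Zᵢ` of (the
lift of) `xᵢ`, so that `Oᵢ ⊆ Zᵢ` (`exists_affineChart_open_subset_irreducibleComponent`,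
Mathlib `closure_sUnion_irreducibleComponents_sdiff_singleton`). The smooth morphism `f` is open (flat and
locally of finite presentation, Mathlib `UniversallyOpen.of_flat`, `Scheme.Hom.isOpenMap`), so
`f(O₀) ∩ f(O₁)` is a non-empty open subset of the irreducible `S`; it contains the point of a complex point
`s'` (`exists_complexPoint_pt_mem_inter`), under which lie complex points `y'ᵢ` of `Vᵢ` inside `Oᵢ ⊆ Zᵢ`
(`exists_complexPoints_map_eq_of_pt_mem_image`). Leg A (chart `V₀`, component `Z₀`, points `x₀, y'₀`)
carries algebraicity from `s₀` to `s'`; leg B (chart `V₁`, component `Z₁`, points `y'₁, x₁`) from `s'` to `s`.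
-/

noncomputable section

-- every declaration of this problem lives in `Summit.HodgeConjecture.HodgeConjecture.…` (summit = sub-problem)
set_option linter.dupNamespace false

open CategoryTheory AlgebraicGeometry TopologicalSpace
open Literature.AlgebraicGeometry.Motives Literature.AlgebraicGeometry.HodgeTheory

namespace Summit.HodgeConjecture.HodgeConjecture.Theorems

/-! ### An affine chart of a complex point together with a non-empty open inside one irreducible component -/

/-- **Affine chart with a thick open.** A complex point `x` of a `ℂ`-scheme `𝒳` locally of finite type lifts
to a complex point `y` of an AFFINE open subscheme `q : V ↪ 𝒳` (`exists_isAffineOpen_mem_and_subset`,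
`AlgPoints.liftOfMemOpensRange`); `V` is Noetherian, so the complement `O` of the union of the irreducible
components of `V` other than the component `Z` of `pt y` is a non-empty open subset of `Z`
(Mathlib `closure_sUnion_irreducibleComponents_sdiff_singleton`). [folklore] -/
theorem exists_affineChart_open_subset_irreducibleComponent {𝒳 : SchemeOver ℂ} [LocallyOfFiniteType 𝒳.hom]
    (x : ComplexPoints 𝒳) :
    ∃ (V : SchemeOver ℂ) (q : V ⟶ 𝒳) (y : ComplexPoints V) (O : Set V.left),
      IsAffine V.left ∧ IsOpenImmersion q.left ∧ AlgPoints.map q y = x ∧ IsOpen O ∧ O.Nonempty ∧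
        O ⊆ irreducibleComponent y.pt := by
  obtain ⟨U, hU, hxU, -⟩ := exists_isAffineOpen_mem_and_subset (Opens.mem_top x.pt)
  -- the affine open subscheme `U` as a `ℂ`-scheme, and its inclusion
  let V : SchemeOver ℂ := Over.mk (U.ι ≫ 𝒳.hom)
  let q : V ⟶ 𝒳 := Over.homMk U.ι rfl
  haveI hq : IsOpenImmersion q.left := by
    change IsOpenImmersion U.ι
    infer_instance
  have hrange : x.pt ∈ q.left.opensRange := ⟨⟨x.pt, hxU⟩, rfl⟩
  let y : ComplexPoints V := AlgPoints.liftOfMemOpensRange q x hrange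
  -- `V = U` is affine of finite type over `ℂ`, hence Noetherian with finitely many irreducible components
  haveI hVaff : IsAffine V.left := hU
  haveI : LocallyOfFiniteType V.hom := by
    change LocallyOfFiniteType (U.ι ≫ 𝒳.hom)
    infer_instance
  haveI : IsLocallyNoetherian V.left := LocallyOfFiniteType.isLocallyNoetherian V.hom
  haveI : CompactSpace V.left := isCompact_univ_iff.mp (isAffineOpen_top V.left).isCompact
  haveI : IsNoetherian V.left := {}
  have hfin : (irreducibleComponents V.left).Finite := NoetherianSpace.finite_irreducibleComponents
  -- the complement of the other components
  set O : Set V.left := (⋃₀ (irreducibleComponents V.left \ {irreducibleComponent y.pt}))ᶜ with hOdef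
  have hO : IsOpen O := by
    rw [hOdef, Set.sUnion_eq_biUnion, isOpen_compl_iff]
    exact hfin.sdiff.isClosed_biUnion fun W hW ↦ isClosed_of_mem_irreducibleComponents W hW.1
  have hcl : closure O = irreducibleComponent y.pt :=
    closure_sUnion_irreducibleComponents_sdiff_singleton hfin _
      (irreducibleComponent_mem_irreducibleComponents y.pt)
  have hOZ : O ⊆ irreducibleComponent y.pt := hcl ▸ subset_closure
  have hOne : O.Nonempty := by
    by_contra hne
    have hZ := (isIrreducible_irreducibleComponent (x := y.pt)).nonempty
    rw [← hcl, Set.not_nonempty_iff_eq_empty.mp hne, closure_empty] at hZ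
    exact Set.not_nonempty_empty hZ
  exact ⟨V, q, y, O, hVaff, hq, AlgPoints.map_liftOfMemOpensRange q x hrange, hO, hOne, hOZ⟩

/-! ### Transport of algebraicity along curves drawn inside the total space -/

section Legs

variable {p M : ℕ}
  (h : ∀ ⦃𝒳 C : SchemeOver ℂ⦄ (f : 𝒳 ⟶ C) (e : C ⟶ 𝒳), e ≫ f = 𝟙 C → IsSmoothProjectiveFamily f (2 * M) →
      IrreducibleSpace C.left → IsAffine C.left → AlgebraicGeometry.Smooth C.hom →
      topologicalKrullDim C.left = 1 → ∀ (W : complexBetti 𝒳 (2 * M)),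
      (∀ s : ComplexPoints C, IsRationalClass (complexBetti.map (fiberι f s) (2 * M) W) ∧
        IsOfHodgeType (2 * M) (fiberOver f s) (2 * M) M M (complexBetti.map (fiberι f s) (2 * M) W)) →
      (∀ s : ComplexPoints C, ∃ (A' : AbelianVariety ℂ) (φ' : A' ⟶ A'), A'.dim = (2 * M) ∧
        φ' ≫ φ' = -((p : ℤ) • 𝟙 A') ∧ Nonempty (A'.X ≅ fiberOver f s)) →
      (∃ s₀ : ComplexPoints C, complexBetti.map (fiberι f s₀) (2 * M) W ∈ algebraicClasses (fiberOver f s₀) M) →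
      ∀ s : ComplexPoints C, complexBetti.map (fiberι f s) (2 * M) W ∈ algebraicClasses (fiberOver f s) M)
  {𝒳 S : SchemeOver ℂ} {f : 𝒳 ⟶ S} (hf : IsSmoothProjectiveFamily f (2 * M)) {W : complexBetti 𝒳 (2 * M)}
  (hW : ∀ s : ComplexPoints S, IsRationalClass (complexBetti.map (fiberι f s) (2 * M) W) ∧
    IsOfHodgeType (2 * M) (fiberOver f s) (2 * M) M M (complexBetti.map (fiberι f s) (2 * M) W))
  (hA : ∀ s : ComplexPoints S, ∃ (A' : AbelianVariety ℂ) (φ' : A' ⟶ A'), A'.dim = (2 * M) ∧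
    φ' ≫ φ' = -((p : ℤ) • 𝟙 A') ∧ Nonempty (A'.X ≅ fiberOver f s))
include h hf hW hA

/-- **Curve leg.** Granted the rung for SECTIONED families over smooth irreducible affine curves, algebraicity
of the restrictions of `W` propagates along any `ℂ`-morphism `k : C ⟶ 𝒳` from a smooth irreducible affine
curve INTO THE TOTAL SPACE: base-change `f` along `k ≫ f : C ⟶ S` (`Motives.familyPullback`); the family
`𝒳 ×_S C ⟶ C` is smooth projective (`IsSmoothProjectiveFamily.familyPullback_snd`) and carries the
tautological section `(k, 𝟙) : C ⟶ 𝒳 ×_S C` (`IsPullback.lift`), its fibre over `c` is the fibre of `f`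
over `f (k c)` (`familyPullback_fibrewise_rational_hodge`, `familyPullback_fibrewise_weil`,
`familyPullback_mem_algebraicClasses_iff`), so the sectioned rung moves algebraicity from `f (k a)` to
`f (k b)`. [folklore] -/
theorem mem_algebraicClasses_of_curve_into_totalSpace {C : SchemeOver ℂ} [IrreducibleSpace C.left]
    [IsAffine C.left] [AlgebraicGeometry.Smooth C.hom] (hdim : topologicalKrullDim C.left = 1)
    (k : C ⟶ 𝒳) (a b : ComplexPoints C)
    (ha : complexBetti.map (fiberι f (AlgPoints.map (k ≫ f) a)) (2 * M) W ∈
      algebraicClasses (fiberOver f (AlgPoints.map (k ≫ f) a)) M) :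
    complexBetti.map (fiberι f (AlgPoints.map (k ≫ f) b)) (2 * M) W ∈
      algebraicClasses (fiberOver f (AlgPoints.map (k ≫ f) b)) M := by
  -- the tautological section of the base change along `k ≫ f`
  have he : (familyPullback.isPullback f (k ≫ f)).lift k (𝟙 C) (by rw [Category.id_comp]) ≫
      familyPullback.snd f (k ≫ f) = 𝟙 C :=
    IsPullback.lift_snd _ _ _ _
  rw [← familyPullback_mem_algebraicClasses_iff (k ≫ f) hf M W b]
  refine h (familyPullback.snd f (k ≫ f)) _ he (hf.familyPullback_snd (k ≫ f)) ‹_› ‹_› ‹_› hdim _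
    (familyPullback_fibrewise_rational_hodge f (k ≫ f) W hW) (familyPullback_fibrewise_weil f (k ≫ f) hA)
    ⟨a, ?_⟩ b
  rw [familyPullback_mem_algebraicClasses_iff (k ≫ f) hf M W a]
  exact ha

/-- **Chart leg.** Granted the sectioned curve rung: for an affine `ℂ`-scheme `V` locally of finite type
with a `ℂ`-morphism `q : V ⟶ 𝒳` (an affine chart of the total space) and two complex points `y, y'` of `V`
on a common closed irreducible `Z ⊆ V`, algebraicity of `W` at `f (q y)` gives algebraicity at `f (q y')`:
if `y = y'` there is nothing to do; otherwise Mumford's lemma (`mumford_smoothCurve_through_two_points_holds`)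
draws a smooth irreducible affine curve `g : C ⟶ V` through `y, y'`, and the curve leg applies to
`g ≫ q : C ⟶ 𝒳`. [cite: MumfordAV1970, §6, Lemma] -/
theorem mem_algebraicClasses_of_isIrreducible_chart {V : SchemeOver ℂ} [IsAffine V.left]
    [LocallyOfFiniteType V.hom] (q : V ⟶ 𝒳) {Z : Set V.left} (hZc : IsClosed Z) (hZi : IsIrreducible Z)
    (y y' : ComplexPoints V) (hy : y.pt ∈ Z) (hy' : y'.pt ∈ Z)
    (halg : complexBetti.map (fiberι f (AlgPoints.map (q ≫ f) y)) (2 * M) W ∈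
      algebraicClasses (fiberOver f (AlgPoints.map (q ≫ f) y)) M) :
    complexBetti.map (fiberι f (AlgPoints.map (q ≫ f) y')) (2 * M) W ∈
      algebraicClasses (fiberOver f (AlgPoints.map (q ≫ f) y')) M := by
  by_cases hyy : y = y'
  · exact hyy ▸ halg
  -- a smooth irreducible affine curve in the chart through `y` and `y'` (Mumford)
  obtain ⟨C, g, a, b, hCaff, hCirr, hCsm, hCdim, -, ha, hb⟩ :=
    mumford_smoothCurve_through_two_points_holds ‹_› ‹_› Z hZc hZi y y' hy hy' hyy
  haveI := hCaff
  haveI := hCirr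
  haveI := hCsm
  have key := mem_algebraicClasses_of_curve_into_totalSpace h hf hW hA hCdim (g ≫ q) a b
  have ea : AlgPoints.map ((g ≫ q) ≫ f) a = AlgPoints.map (q ≫ f) y := by
    rw [Category.assoc, AlgPoints.map_comp_apply g (q ≫ f) a, ha]
  have eb : AlgPoints.map ((g ≫ q) ≫ f) b = AlgPoints.map (q ≫ f) y' := by
    rw [Category.assoc, AlgPoints.map_comp_apply g (q ≫ f) b, hb]
  rw [ea, eb] at key
  exact key halg

end Legs

/-! ### The reduction -/

/-- **Stub `stub_sectionedCurveReduction` (skeleton v4 of line `Sketch`, crux stmt-HodgeConjecture-14497).**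
The rung of `WeilVariationalHodge` for SECTIONED families over smooth irreducible affine CURVES implies the rung
over smooth irreducible AFFINE bases. Fix the anchor `s₀` and the target `s` in `S(ℂ)` and complex points
`x₀ ∈ 𝒳_{s₀}(ℂ)`, `x₁ ∈ 𝒳_s(ℂ)` (`nonempty_complexPoints`). Each `xᵢ` lifts to an affine chart `Vᵢ ↪ 𝒳`
carrying a non-empty open `Oᵢ` inside the irreducible component `Zᵢ` of the lift
(`exists_affineChart_open_subset_irreducibleComponent`). The smooth `f` is open (flat and locally of finite
presentation, Mathlib `UniversallyOpen.of_flat`), so `f(O₀) ∩ f(O₁)` is a non-empty open of the irreducible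
`S` and contains the point of a complex point `s'` (`exists_complexPoint_pt_mem_inter`), under which lie
complex points `y'ᵢ ∈ Oᵢ ⊆ Zᵢ` (`exists_complexPoints_map_eq_of_pt_mem_image`). Two chart legs
(`mem_algebraicClasses_of_isIrreducible_chart`: Mumford's curve through two points of `Zᵢ`, base change
along `C ⟶ 𝒳 ⟶ S` with its tautological section, the sectioned curve rung) carry algebraicity from `s₀`
to `s'` inside `Z₀` and from `s'` to `s` inside `Z₁`. [cite: MumfordAV1970, §6, Lemma] -/
theorem stub_sectionedCurveReduction (p M : ℕ)
    (h : ∀ ⦃𝒳 C : SchemeOver ℂ⦄ (f : 𝒳 ⟶ C) (e : C ⟶ 𝒳), e ≫ f = 𝟙 C → IsSmoothProjectiveFamily f (2 * M) →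
      IrreducibleSpace C.left → IsAffine C.left → AlgebraicGeometry.Smooth C.hom →
      topologicalKrullDim C.left = 1 → ∀ (W : complexBetti 𝒳 (2 * M)),
      (∀ s : ComplexPoints C, IsRationalClass (complexBetti.map (fiberι f s) (2 * M) W) ∧
        IsOfHodgeType (2 * M) (fiberOver f s) (2 * M) M M (complexBetti.map (fiberι f s) (2 * M) W)) →
      (∀ s : ComplexPoints C, ∃ (A' : AbelianVariety ℂ) (φ' : A' ⟶ A'), A'.dim = (2 * M) ∧
        φ' ≫ φ' = -((p : ℤ) • 𝟙 A') ∧ Nonempty (A'.X ≅ fiberOver f s)) →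
      (∃ s₀ : ComplexPoints C, complexBetti.map (fiberι f s₀) (2 * M) W ∈ algebraicClasses (fiberOver f s₀) M) →
      ∀ s : ComplexPoints C, complexBetti.map (fiberι f s) (2 * M) W ∈ algebraicClasses (fiberOver f s) M) :
    ∀ ⦃𝒳 S : SchemeOver ℂ⦄ (f : 𝒳 ⟶ S), IsSmoothProjectiveFamily f (2 * M) → IrreducibleSpace S.left →
      IsAffine S.left → AlgebraicGeometry.Smooth S.hom → ∀ (W : complexBetti 𝒳 (2 * M)),
      (∀ s : ComplexPoints S, IsRationalClass (complexBetti.map (fiberι f s) (2 * M) W) ∧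
        IsOfHodgeType (2 * M) (fiberOver f s) (2 * M) M M (complexBetti.map (fiberι f s) (2 * M) W)) →
      (∀ s : ComplexPoints S, ∃ (A' : AbelianVariety ℂ) (φ' : A' ⟶ A'), A'.dim = (2 * M) ∧
        φ' ≫ φ' = -((p : ℤ) • 𝟙 A') ∧ Nonempty (A'.X ≅ fiberOver f s)) →
      (∃ s₀ : ComplexPoints S, complexBetti.map (fiberι f s₀) (2 * M) W ∈ algebraicClasses (fiberOver f s₀) M) →
      ∀ s : ComplexPoints S, complexBetti.map (fiberι f s) (2 * M) W ∈ algebraicClasses (fiberOver f s) M := by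
  intro 𝒳 S f hf hirr haff hsm W hW hA hs₀ s
  obtain ⟨s₀, hs₀⟩ := hs₀
  haveI := hirr
  haveI := haff
  haveI := hsm
  haveI : AlgebraicGeometry.Smooth f.left := hf.smooth
  haveI : LocallyOfFiniteType 𝒳.hom := by rw [← Over.w f]; infer_instance
  -- (1) complex points of the total space over the anchor and over the target
  obtain ⟨z₀⟩ := nonempty_complexPoints (hf.isSmoothProjective s₀)
  obtain ⟨z₁⟩ := nonempty_complexPoints (hf.isSmoothProjective s)
  -- (2) affine charts around them with non-empty opens inside one irreducible component
  obtain ⟨V₀, q₀, y₀, O₀, hV₀, hq₀, hy₀, hO₀, hO₀ne, hO₀Z⟩ :=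
    exists_affineChart_open_subset_irreducibleComponent (AlgPoints.map (fiberι f s₀) z₀)
  obtain ⟨V₁, q₁, y₁, O₁, hV₁, hq₁, hy₁, hO₁, hO₁ne, hO₁Z⟩ :=
    exists_affineChart_open_subset_irreducibleComponent (AlgPoints.map (fiberι f s) z₁)
  haveI := hV₀
  haveI := hq₀
  haveI := hV₁
  haveI := hq₁
  haveI : LocallyOfFiniteType V₀.hom := by rw [← Over.w q₀]; infer_instance
  haveI : LocallyOfFiniteType V₁.hom := by rw [← Over.w q₁]; infer_instance
  haveI : LocallyOfFiniteType (q₀ ≫ f).left := by rw [Over.comp_left]; infer_instance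
  haveI : LocallyOfFiniteType (q₁ ≫ f).left := by rw [Over.comp_left]; infer_instance
  -- (3) the images `f(Oᵢ)` are non-empty opens of the irreducible `S` (smooth ⇒ open), so they meet
  have hopen : ∀ {V : SchemeOver ℂ} (q : V ⟶ 𝒳) [IsOpenImmersion q.left] {O : Set V.left}, IsOpen O →
      IsOpen (((q ≫ f).left : V.left → S.left) '' O) := fun q _ O hO => by
    have h2 := f.left.isOpenMap _ (q.left.isOpenMap O hO)
    rw [Set.image_image] at h2
    exact h2
  obtain ⟨v, hv₀, hv₁⟩ := nonempty_preirreducible_inter (hopen q₀ hO₀) (hopen q₁ hO₁) (hO₀ne.image _)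
    (hO₁ne.image _)
  -- (4) a complex point `s'` of `S` in the intersection, and complex points `y'ᵢ ∈ Oᵢ` over it
  obtain ⟨s', hs'⟩ := exists_complexPoint_pt_mem_inter ((hopen q₀ hO₀).inter (hopen q₁ hO₁)) isClosed_univ
    ⟨v, ⟨hv₀, hv₁⟩, Set.mem_univ v⟩
  obtain ⟨y₀', hy₀'O, hy₀'s⟩ := exists_complexPoints_map_eq_of_pt_mem_image (q₀ ≫ f) hO₀ s' hs'.1.1
  obtain ⟨y₁', hy₁'O, hy₁'s⟩ := exists_complexPoints_map_eq_of_pt_mem_image (q₁ ≫ f) hO₁ s' hs'.1.2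
  -- (5) leg A: from `s₀ = f (q₀ y₀)` to `s' = f (q₀ y'₀)` inside the component of `y₀`
  have hlegA := mem_algebraicClasses_of_isIrreducible_chart h hf hW hA q₀ isClosed_irreducibleComponent
    isIrreducible_irreducibleComponent y₀ y₀' mem_irreducibleComponent (hO₀Z hy₀'O)
    (by rw [AlgPoints.map_comp_apply, hy₀, AlgPoints.map_map_fiberι]; exact hs₀)
  rw [hy₀'s, ← hy₁'s] at hlegA
  -- (6) leg B: from `s' = f (q₁ y'₁)` to `s = f (q₁ y₁)` inside the component of `y₁`
  have hlegB := mem_algebraicClasses_of_isIrreducible_chart h hf hW hA q₁ isClosed_irreducibleComponent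
    isIrreducible_irreducibleComponent y₁' y₁ (hO₁Z hy₁'O) mem_irreducibleComponent hlegA
  rwa [AlgPoints.map_comp_apply, hy₁, AlgPoints.map_map_fiberι] at hlegB

end Summit.HodgeConjecture.HodgeConjecture.Theorems

end
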